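import Summits.AtomisticToContinuum.BoseEinsteinCondensation.Theorems.BECHeatBathGapJastrowDobrushinRungTransfer

/-!
# Route `BECHeatBathGap` — support item `JastrowDobrushinRung` (stmt-AtomisticToContinuum-14373):
# symmetry of `P` and the abstract approximate-tensorisation theorem (helper file 5)

Helpers for the proof of
`Summit.AtomisticToContinuum.BoseEinsteinCondensation.Theses.BECHeatBathGap.JastrowDobrushinRung`
(approximate tensorisation of variance with constant 2 for the Jastrow law under
`5N∫(1-f²) ≤ L³`, via Dobrushin uniqueness ⇒ heat-bath spectral gap ≥ 1 - r, Wu 2006, re-proved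
from scratch). As in helper file 1, the operators `S` (one-site average), `T` (heat bath),
`P = N⁻¹∑T_j` (random-scan Gibbs sampler) and the weights `w = B_j π_j` are variables with
defining hypotheses `hS, hT, hP, hw, …` (no auxiliary definitions).

This file: `⟨H, PF⟩_w = N⁻¹∑⟨H,T_jF⟩_w`, the symmetry `P_symm`, the shift identity for
iterates, and the abstract theorem `integral_sub_mean_sq_mul_w_le`:
under a uniform Dobrushin pair influence `c` with `r = (N-1)c < 1`,
`∫ (F - c₀)² w ≤ (1-r)⁻¹ ∑_j ∫ (F - g_j)² w` (`c₀` the `w`-mean of `F`) for bounded measurable `F`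
and bounded measurable `g_j` not depending on `x_j` — the heat-bath spectral gap is `≥ 1 - r`.
-/

noncomputable section

namespace Summit.AtomisticToContinuum.BoseEinsteinCondensation.Theorems

namespace JastrowDobrushin

open MeasureTheory Function
open scoped ENNReal

variable {ι : Type*} [DecidableEq ι] {E : Type*} [MeasurableSpace E]
  {u : Measure E} {S : ι → ((ι → E) → ℝ) → (ι → E) → ℝ}
variable {π : ι → (ι → E) → ℝ} {T : ι → ((ι → E) → ℝ) → (ι → E) → ℝ}
variable {w : (ι → E) → ℝ} {B : ι → (ι → E) → ℝ}
variable {P : ((ι → E) → ℝ) → (ι → E) → ℝ}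

/-! ### Symmetry of `P` in `L²(w)` and the Cauchy–Schwarz chain -/

/-- `⟨H, P F⟩_w = N⁻¹ ∑_j ⟨H, T_j F⟩_w`. [folklore] -/
theorem integral_mul_P_mul_w [Fintype ι] [IsProbabilityMeasure u]
    (hS : ∀ j G X, S j G X = ∫ y, G (update X j y) ∂u)
    (hT : ∀ j F X, T j F X = S j (fun Y => F Y * π j Y) X / S j (π j) X)
    (hπ : ∀ j, Measurable (π j) ∧ ∀ X, 0 ≤ π j X ∧ π j X ≤ 1) (hZ : ∀ j X, 0 < S j (π j) X)
    (hw : ∀ j X, w X = B j X * π j X)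
    (hB : ∀ j, Measurable (B j) ∧ (∀ X, 0 ≤ B j X ∧ B j X ≤ 1) ∧ ∀ X y, B j (update X j y) = B j X)
    (hP : ∀ F X, P F X = (Fintype.card ι : ℝ)⁻¹ * ∑ j, T j F X)
    {F H : (ι → E) → ℝ} (hFm : Measurable F) (hHm : Measurable H) {C C' : ℝ}
    (hFb : ∀ X, |F X| ≤ C) (hHb : ∀ X, |H X| ≤ C') :
    ∫ X, H X * P F X * w X ∂(Measure.pi fun _ : ι => u) =
      (Fintype.card ι : ℝ)⁻¹ * ∑ j, ∫ X, H X * T j F X * w X ∂(Measure.pi fun _ : ι => u) := by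
  rcases isEmpty_or_nonempty ι with hι | hι
  · simp [hP]
  have j₀ : ι := Classical.arbitrary ι
  have hwm := measurable_w hπ hw hB j₀
  have hw1 := w_mem hπ hw hB j₀
  have h1 : (fun X => H X * P F X * w X) =
      fun X => ∑ j, (Fintype.card ι : ℝ)⁻¹ * (H X * T j F X * w X) := by
    funext X
    rw [hP, Finset.mul_sum, Finset.mul_sum, Finset.sum_mul]
    exact Finset.sum_congr rfl fun j _ => by ring
  have hint : ∀ j, Integrable (fun X => (Fintype.card ι : ℝ)⁻¹ * (H X * T j F X * w X))
      (Measure.pi fun _ : ι => u) := fun j =>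
    (integrable_mul_w (Φ := fun X => H X * T j F X) (hHm.mul (measurable_T hS hT hπ j hFm))
      (C := C' * C) (fun X => by
        rw [abs_mul]
        exact mul_le_mul (hHb X) (abs_T_le hS hT hπ hZ j hFm hFb X) (abs_nonneg _)
          ((abs_nonneg _).trans (hHb X))) hwm hw1).const_mul _
  rw [h1, integral_finsetSum _ fun j _ => hint j, Finset.mul_sum]
  simp_rw [integral_const_mul]

/-- **Symmetry of the Gibbs sampler**: `⟨H, P F⟩_w = ⟨P H, F⟩_w`. [folklore] -/
theorem P_symm [Fintype ι] [IsProbabilityMeasure u]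
    (hS : ∀ j G X, S j G X = ∫ y, G (update X j y) ∂u)
    (hT : ∀ j F X, T j F X = S j (fun Y => F Y * π j Y) X / S j (π j) X)
    (hπ : ∀ j, Measurable (π j) ∧ ∀ X, 0 ≤ π j X ∧ π j X ≤ 1) (hZ : ∀ j X, 0 < S j (π j) X)
    (hw : ∀ j X, w X = B j X * π j X)
    (hB : ∀ j, Measurable (B j) ∧ (∀ X, 0 ≤ B j X ∧ B j X ≤ 1) ∧ ∀ X y, B j (update X j y) = B j X)
    (hP : ∀ F X, P F X = (Fintype.card ι : ℝ)⁻¹ * ∑ j, T j F X)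
    {F H : (ι → E) → ℝ} (hFm : Measurable F) (hHm : Measurable H) {C C' : ℝ}
    (hFb : ∀ X, |F X| ≤ C) (hHb : ∀ X, |H X| ≤ C') :
    ∫ X, H X * P F X * w X ∂(Measure.pi fun _ : ι => u) =
      ∫ X, P H X * F X * w X ∂(Measure.pi fun _ : ι => u) := by
  have h2 : (fun X => P H X * F X * w X) = fun X => F X * P H X * w X := funext fun X => by ring
  rw [integral_mul_P_mul_w hS hT hπ hZ hw hB hP hFm hHm hFb hHb, h2,
    integral_mul_P_mul_w hS hT hπ hZ hw hB hP hHm hFm hHb hFb]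
  congr 1
  refine Finset.sum_congr rfl fun j _ => ?_
  rw [T_symm hS hT hπ hZ hw hB j hFm hHm hFb hHb]
  exact integral_congr_ae (ae_of_all _ fun X => by simp only; ring)

/-- Moving one `P` across the `w`-inner product between iterates. [folklore] -/
theorem integral_iterate_P_shift [Fintype ι] [IsProbabilityMeasure u]
    (hS : ∀ j G X, S j G X = ∫ y, G (update X j y) ∂u)
    (hT : ∀ j F X, T j F X = S j (fun Y => F Y * π j Y) X / S j (π j) X)
    (hπ : ∀ j, Measurable (π j) ∧ ∀ X, 0 ≤ π j X ∧ π j X ≤ 1) (hZ : ∀ j X, 0 < S j (π j) X)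
    (hw : ∀ j X, w X = B j X * π j X)
    (hB : ∀ j, Measurable (B j) ∧ (∀ X, 0 ≤ B j X ∧ B j X ≤ 1) ∧ ∀ X y, B j (update X j y) = B j X)
    (hP : ∀ F X, P F X = (Fintype.card ι : ℝ)⁻¹ * ∑ j, T j F X)
    {F H : (ι → E) → ℝ} (hFm : Measurable F) (hHm : Measurable H) {C C' : ℝ}
    (hFb : ∀ X, |F X| ≤ C) (hHb : ∀ X, |H X| ≤ C') (a b : ℕ) :
    ∫ X, (P^[a] H) X * (P^[b] F) X * w X ∂(Measure.pi fun _ : ι => u) =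
      ∫ X, H X * (P^[a + b] F) X * w X ∂(Measure.pi fun _ : ι => u) := by
  induction a generalizing b with
  | zero => simp
  | succ a ih =>
    have h1 : ∫ X, (P^[a + 1] H) X * (P^[b] F) X * w X ∂(Measure.pi fun _ : ι => u) =
        ∫ X, (P^[a] H) X * (P^[b + 1] F) X * w X ∂(Measure.pi fun _ : ι => u) := by
      rw [Function.iterate_succ_apply', Function.iterate_succ_apply']
      exact (P_symm hS hT hπ hZ hw hB hP (measurable_iterate_P hS hT hπ hP b hFm)
        (measurable_iterate_P hS hT hπ hP a hHm) (abs_iterate_P_le hS hT hπ hZ hP b hFm hFb)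
        (abs_iterate_P_le hS hT hπ hZ hP a hHm hHb)).symm
    rw [h1, ih (b + 1), show a + (b + 1) = a + 1 + b by omega]


/-! ### The abstract approximate-tensorisation theorem -/

/-- **Poincaré inequality for the Gibbs sampler under a Dobrushin condition (abstract form).**
On the product probability space `(E^ι, u^{⊗ι})` let `w = B_j π_j ∈ [0,1]` be a weight with
`B_j` not depending on `x_j` and one-site partition functions `S_j π_j > 0`, and suppose the
one-site conditional laws satisfy Dobrushin's condition with a uniform pair influence `c ≥ 0`
and row sum `r = (N-1)c < 1` (`N = |ι|`). Then for every bounded measurable `F` and bounded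
measurable predictors `g_j` not depending on `x_j`,
`∫ (F - c₀)² w ≤ (1 - r)⁻¹ ∑_j ∫ (F - g_j)² w`, `c₀ = ∫ F w / ∫ w` —
i.e. the heat-bath spectral gap is at least `1 - r` (Wu 2006, for Dobrushin's TV coefficients;
here re-proved from scratch by oscillation contraction and the log-convexity transfer).
[folklore] -/
theorem integral_sub_mean_sq_mul_w_le [Fintype ι] [Nonempty ι] [IsProbabilityMeasure u]
    (hS : ∀ j G X, S j G X = ∫ y, G (update X j y) ∂u)
    (hT : ∀ j F X, T j F X = S j (fun Y => F Y * π j Y) X / S j (π j) X)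
    (hπ : ∀ j, Measurable (π j) ∧ ∀ X, 0 ≤ π j X ∧ π j X ≤ 1) (hZ : ∀ j X, 0 < S j (π j) X)
    (hw : ∀ j X, w X = B j X * π j X)
    (hB : ∀ j, Measurable (B j) ∧ (∀ X, 0 ≤ B j X ∧ B j X ≤ 1) ∧ ∀ X y, B j (update X j y) = B j X)
    (hP : ∀ F X, P F X = (Fintype.card ι : ℝ)⁻¹ * ∑ j, T j F X) {c : ℝ} (hc : 0 ≤ c)
    (hD : ∀ j k, j ≠ k → ∀ (X : ι → E) (y y' : E) (φ : E → ℝ) (Cφ δ : ℝ), Measurable φ →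
      (∀ z, |φ z| ≤ Cφ) → (∀ z z', |φ z - φ z'| ≤ δ) →
      |T j (fun Y => φ (Y j)) (update X k y) - T j (fun Y => φ (Y j)) (update X k y')| ≤ c * δ)
    (hr : ((Fintype.card ι : ℝ) - 1) * c < 1)
    {F : (ι → E) → ℝ} (hFm : Measurable F) {C : ℝ} (hFb : ∀ X, |F X| ≤ C)
    {g : ι → (ι → E) → ℝ} (hgm : ∀ j, Measurable (g j)) {C' : ℝ} (hgb : ∀ j X, |g j X| ≤ C')
    (hg : ∀ j X y, g j (update X j y) = g j X) :
    ∫ X, (F X - (∫ Y, F Y * w Y ∂(Measure.pi fun _ : ι => u)) /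
        (∫ Y, w Y ∂(Measure.pi fun _ : ι => u))) ^ 2 * w X ∂(Measure.pi fun _ : ι => u) ≤
      (1 - ((Fintype.card ι : ℝ) - 1) * c)⁻¹ *
        ∑ j, ∫ X, (F X - g j X) ^ 2 * w X ∂(Measure.pi fun _ : ι => u) := by
  set ν : Measure (ι → E) := Measure.pi fun _ : ι => u with hν
  have j₀ : ι := Classical.arbitrary ι
  have hwm := measurable_w hπ hw hB j₀
  have hw1 := w_mem hπ hw hB j₀
  set N : ℝ := (Fintype.card ι : ℝ) with hN
  have hNpos : 0 < N := by rw [hN]; exact_mod_cast Fintype.card_pos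
  set ρ : ℝ := (N - 1) * (1 + c) / N with hρ
  have hρ1 : 1 - ρ = (1 - (N - 1) * c) / N := by
    rw [hρ]; field_simp; ring
  set m : ℝ := ∫ Y, w Y ∂ν with hm
  set c₀ : ℝ := (∫ Y, F Y * w Y ∂ν) / m with hc₀
  have hiw : Integrable w ν := integrable_of_bounded hwm (C := 1) fun Y => by
    rw [abs_of_nonneg (hw1 Y).1]; exact (hw1 Y).2
  have hRHS : 0 ≤ (1 - (N - 1) * c)⁻¹ * ∑ j, ∫ X, (F X - g j X) ^ 2 * w X ∂ν :=
    mul_nonneg (inv_nonneg.mpr (by linarith)) (Finset.sum_nonneg fun j _ =>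
      integral_nonneg fun X => mul_nonneg (sq_nonneg _) (hw1 X).1)
  rcases (integral_nonneg fun X => (hw1 X).1 : 0 ≤ m).eq_or_lt with hm0 | hmpos
  · -- degenerate case `∫ w = 0`: `w = 0` a.e. and the left-hand side vanishes
    have hw0 : w =ᵐ[ν] 0 := (integral_eq_zero_iff_of_nonneg (fun X => (hw1 X).1) hiw).mp hm0.symm
    have h0 : ∫ X, (F X - c₀) ^ 2 * w X ∂ν = 0 :=
      integral_eq_zero_of_ae (hw0.mono fun X hX => by simp [hX])
    rw [h0]
    exact hRHS
  -- the centred function `F₀ = F - c₀`, of `w`-mean zero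
  set F₀ : (ι → E) → ℝ := fun X => F X - c₀ with hF₀
  have hF₀m : Measurable F₀ := hFm.sub measurable_const
  have hF₀b : ∀ X, |F₀ X| ≤ C + |c₀| := fun X =>
    (abs_sub _ _).trans (add_le_add (hFb X) le_rfl)
  have hiFw : Integrable (fun X => F X * w X) ν := integrable_mul_w hFm hFb hwm hw1
  have hF₀mean : ∫ X, F₀ X * w X ∂ν = 0 := by
    have h1 : (fun X => F₀ X * w X) = fun X => F X * w X - c₀ * w X := by
      funext X; simp only [hF₀]; ring
    rw [h1, integral_sub hiFw (hiw.const_mul _), integral_const_mul, hc₀,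
      div_mul_cancel₀ _ hmpos.ne', sub_self]
  -- the sequence `a n = ⟨F₀, Pⁿ F₀⟩_w`
  set a : ℕ → ℝ := fun n => ∫ X, F₀ X * (P^[n] F₀) X * w X ∂ν with ha
  have hPm : ∀ n, Measurable (P^[n] F₀) := fun n => measurable_iterate_P hS hT hπ hP n hF₀m
  have hPb : ∀ n X, |(P^[n] F₀) X| ≤ C + |c₀| := fun n =>
    abs_iterate_P_le hS hT hπ hZ hP n hF₀m hF₀b
  have a0 : a 0 = ∫ X, F₀ X * F₀ X * w X ∂ν := by simp [ha]
  have h0 : 0 ≤ a 0 :=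
    a0 ▸ integral_nonneg fun X => mul_nonneg (mul_self_nonneg _) (hw1 X).1
  have a1 : a 1 = N⁻¹ * ∑ j, ∫ X, F₀ X * T j F₀ X * w X ∂ν := by
    simp only [ha, Function.iterate_one]
    exact integral_mul_P_mul_w hS hT hπ hZ hw hB hP hF₀m hF₀m hF₀b hF₀b
  have h1 : 0 ≤ a 1 :=
    a1 ▸ mul_nonneg (inv_nonneg.mpr hNpos.le) (Finset.sum_nonneg fun j _ =>
      integral_mul_T_mul_w_nonneg hS hT hπ hZ hw hB j hF₀m hF₀b)
  -- Cauchy–Schwarz along the dyadic subsequence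
  have hCS : ∀ k : ℕ, a (2 ^ k) ^ 2 ≤ a 0 * a (2 ^ (k + 1)) := by
    intro k
    have hsym : ∫ X, (P^[2 ^ k] F₀) X * (P^[2 ^ k] F₀) X * w X ∂ν = a (2 ^ (k + 1)) := by
      simp only [ha]
      rw [integral_iterate_P_shift hS hT hπ hZ hw hB hP hF₀m hF₀m hF₀b hF₀b (2 ^ k) (2 ^ k),
        show 2 ^ k + 2 ^ k = 2 ^ (k + 1) by ring]
    rw [a0, ← hsym]
    exact integral_mul_mul_sq_le hF₀m (hPm _) hF₀b (hPb _) hwm hw1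
  -- geometric decay of `a n` from the oscillation contraction
  set D : ℝ := ∑ _k : ι, 2 * (C + |c₀|) with hD'
  set K : ℝ := D * ∫ X, |F₀ X| * w X ∂ν with hK'
  have hρ0 : 0 ≤ ρ := by
    have : (1 : ℝ) ≤ N := by rw [hN]; exact_mod_cast Fintype.card_pos
    exact div_nonneg (mul_nonneg (by linarith) (by linarith)) hNpos.le
  have hK : ∀ n : ℕ, 1 ≤ n → a n ≤ K * ρ ^ n := by
    intro n _
    obtain ⟨d', hd', hsum⟩ := osc_iterate_P hS hT hπ hZ hP hc hD n hF₀m hF₀b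
      (d := fun _ => 2 * (C + |c₀|)) (fun k X y y' =>
        (abs_sub _ _).trans (by linarith [hF₀b (update X k y), hF₀b (update X k y')]))
    have hmean : ∫ X, (P^[n] F₀) X * w X ∂ν = 0 := by
      rw [integral_iterate_P_mul_w hS hT hπ hZ hw hB hP n hF₀m hF₀b, hF₀mean]
    have hsup : ∀ X, |(P^[n] F₀) X| ≤ ρ ^ n * D := fun X =>
      (abs_le_sum_osc_of_integral_eq_zero (hPm n) (hPb n) hwm hw1 hmpos hmean hd' X).trans hsum
    have hi1 : Integrable (fun X => F₀ X * (P^[n] F₀) X * w X) ν :=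
      integrable_mul_w (hF₀m.mul (hPm n)) (C := (C + |c₀|) * (C + |c₀|)) (fun X => by
        rw [abs_mul]; exact mul_le_mul (hF₀b X) (hPb n X) (abs_nonneg _)
          ((abs_nonneg _).trans (hF₀b X))) hwm hw1
    have hi2 : Integrable (fun X => |F₀ X| * w X) ν :=
      integrable_mul_w hF₀m.abs (C := C + |c₀|) (fun X => by rw [abs_abs]; exact hF₀b X) hwm hw1
    calc a n = ∫ X, F₀ X * (P^[n] F₀) X * w X ∂ν := rfl
      _ ≤ ∫ X, (ρ ^ n * D) * (|F₀ X| * w X) ∂ν := by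
          refine integral_mono hi1 (hi2.const_mul _) fun X => ?_
          simp only
          calc F₀ X * (P^[n] F₀) X * w X ≤ |F₀ X * (P^[n] F₀) X| * w X :=
                mul_le_mul_of_nonneg_right (le_abs_self _) (hw1 X).1
            _ = |F₀ X| * |(P^[n] F₀) X| * w X := by rw [abs_mul]
            _ ≤ |F₀ X| * (ρ ^ n * D) * w X :=
                mul_le_mul_of_nonneg_right (mul_le_mul_of_nonneg_left (hsup X) (abs_nonneg _))
                  (hw1 X).1
            _ = (ρ ^ n * D) * (|F₀ X| * w X) := by ring
      _ = K * ρ ^ n := by rw [integral_const_mul, hK']; ring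
  -- the transfer: `a 1 ≤ ρ a 0`
  have hgeom : a 1 ≤ ρ * a 0 := le_mul_of_sq_chain a hρ0 h0 h1 hCS hK
  -- `⟨F₀, T_j F₀⟩ = a 0 - ∫ (F₀ - T_j F₀)² w`
  have hTj : ∀ j, ∫ X, F₀ X * T j F₀ X * w X ∂ν =
      a 0 - ∫ X, (F₀ X - T j F₀ X) ^ 2 * w X ∂ν := by
    intro j
    have hTm := measurable_T hS hT hπ j hF₀m
    have hTb := abs_T_le hS hT hπ hZ j hF₀m hF₀b
    have i1 : Integrable (fun X => F₀ X * F₀ X * w X) ν :=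
      integrable_mul_w (hF₀m.mul hF₀m) (C := (C + |c₀|) * (C + |c₀|)) (fun X => by
        rw [abs_mul]; exact mul_le_mul (hF₀b X) (hF₀b X) (abs_nonneg _)
          ((abs_nonneg _).trans (hF₀b X))) hwm hw1
    have i2 : Integrable (fun X => F₀ X * T j F₀ X * w X) ν :=
      integrable_mul_w (hF₀m.mul hTm) (C := (C + |c₀|) * (C + |c₀|)) (fun X => by
        rw [abs_mul]; exact mul_le_mul (hF₀b X) (hTb X) (abs_nonneg _)
          ((abs_nonneg _).trans (hF₀b X))) hwm hw1
    have i3 : Integrable (fun X => T j F₀ X * T j F₀ X * w X) ν :=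
      integrable_mul_w (hTm.mul hTm) (C := (C + |c₀|) * (C + |c₀|)) (fun X => by
        rw [abs_mul]; exact mul_le_mul (hTb X) (hTb X) (abs_nonneg _)
          ((abs_nonneg _).trans (hTb X))) hwm hw1
    have hpt : (fun X => (F₀ X - T j F₀ X) ^ 2 * w X) = fun X =>
        (F₀ X * F₀ X * w X - 2 * (F₀ X * T j F₀ X * w X)) + T j F₀ X * T j F₀ X * w X := by
      funext X; ring
    have i2' : Integrable (fun X => 2 * (F₀ X * T j F₀ X * w X)) ν := i2.const_mul 2
    have i12 : Integrable (fun X => F₀ X * F₀ X * w X - 2 * (F₀ X * T j F₀ X * w X)) ν :=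
      i1.sub i2'
    rw [hpt, integral_add i12 i3, integral_sub i1 i2', integral_const_mul,
      integral_T_mul_T_mul_w hS hT hπ hZ hw hB j hF₀m hF₀b, a0]
    ring
  -- each deficit is at most `∫ (F - g_j)² w`
  have hDj : ∀ j, ∫ X, (F₀ X - T j F₀ X) ^ 2 * w X ∂ν ≤ ∫ X, (F X - g j X) ^ 2 * w X ∂ν := by
    intro j
    have h := integral_sub_T_sq_mul_w_le hS hT hπ hZ hw hB j hF₀m
      ((hgm j).sub measurable_const) hF₀b (g := fun X => g j X - c₀) (C' := C' + |c₀|)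
      (fun X => (abs_sub _ _).trans (add_le_add (hgb j X) le_rfl))
      (fun X y => by simp only [hg])
    have h2 : (fun X => (F₀ X - (g j X - c₀)) ^ 2 * w X) = fun X => (F X - g j X) ^ 2 * w X := by
      funext X; simp only [hF₀]; ring
    rwa [h2] at h
  -- assemble
  have hLHS : ∫ X, (F X - c₀) ^ 2 * w X ∂ν = a 0 := by
    rw [a0]; congr 1; funext X; simp only [hF₀]; ring
  rw [hLHS]
  have hsum : a 1 = a 0 - N⁻¹ * ∑ j, ∫ X, (F₀ X - T j F₀ X) ^ 2 * w X ∂ν := by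
    rw [a1]; simp_rw [hTj]
    rw [Finset.sum_sub_distrib, Finset.sum_const, Finset.card_univ, nsmul_eq_mul, ← hN, mul_sub,
      ← mul_assoc, inv_mul_cancel₀ hNpos.ne', one_mul]
  have hkey : (1 - (N - 1) * c) * a 0 ≤ ∑ j, ∫ X, (F₀ X - T j F₀ X) ^ 2 * w X ∂ν := by
    have h2 : (1 - ρ) * a 0 ≤ N⁻¹ * ∑ j, ∫ X, (F₀ X - T j F₀ X) ^ 2 * w X ∂ν := by linarith
    rw [hρ1] at h2
    have h3 := mul_le_mul_of_nonneg_left h2 hNpos.le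
    rwa [← mul_assoc, mul_div_cancel₀ _ hNpos.ne', ← mul_assoc, mul_inv_cancel₀ hNpos.ne',
      one_mul] at h3
  have h1r : 0 < 1 - (N - 1) * c := by linarith
  calc a 0 = (1 - (N - 1) * c)⁻¹ * ((1 - (N - 1) * c) * a 0) := by
        rw [← mul_assoc, inv_mul_cancel₀ h1r.ne', one_mul]
    _ ≤ (1 - (N - 1) * c)⁻¹ * ∑ j, ∫ X, (F₀ X - T j F₀ X) ^ 2 * w X ∂ν :=
        mul_le_mul_of_nonneg_left hkey (inv_nonneg.mpr h1r.le)
    _ ≤ (1 - (N - 1) * c)⁻¹ * ∑ j, ∫ X, (F X - g j X) ^ 2 * w X ∂ν :=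
        mul_le_mul_of_nonneg_left (Finset.sum_le_sum fun j _ => hDj j) (inv_nonneg.mpr h1r.le)

end JastrowDobrushin

end Summit.AtomisticToContinuum.BoseEinsteinCondensation.Theorems
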